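import Literature.NumberTheory.LFunctions.Zhang2022.RepairBlenLambda

/-!
# Zhang (2022) §18-margin repair rung, programme F-S3 §E (cell landau-siegel, barrier extension; 𝒟_len intake,
# the last uncovered (L-b)∣Λ sub-word «(or whole profile [0, θ])»): the `R⁺⁺` family «ONE Λχψ-type piece whose
# profile lives on the WHOLE range `[0, θ]`, `θ > 1`, glued to an in-class bulk» — `familyLambdaWhole K X`,
# `familyLambdaWholeAll`, the exact criterion of its block, and the embedding of the overhang row (p467353)

Y. Zhang, *Discrete mean estimates and the Landau–Siegel zero*, arXiv:2211.02515v1 [Zhang2022LandauSiegel] —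
an unrefereed manuscript under adjudication. **WHAT THIS IS NOT: not a claim about Theorems 1–2 of
arXiv:2211.02515, about Landau–Siegel zeros, about a repaired `Margin232`, or about Parity; nothing here asserts
any claim of the manuscript or any estimate. The programme SEARCHES and TYPES; no claim until a kernel theorem
says so.** This file is the §E wrap, in EXACTLY the shape of `Repair.familyLambdaOverhangAll` (RepairBlenLambda,
p467353, REF-E E-15 PASS) and of `Repair.familyLambdaBlockAll` (RepairLambdaBlock, B-multi's in-length M2, E-14), of
the one coordinate of the B-len word's (L-b)∣Λ clause that p467353 DECLARED UNCOVERED: the parenthesis «(or whole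
profile [0, θ])» — a single Λχψ-type piece of top `θ > 1` whose profile is supported on the whole logarithmic range
`[0, θ]` (a bulk part on `[0,1)` AND an overhang part on `[1,θ]`, glued at the wall), added with a balanced amplitude
to an in-class kinked bulk `u`. The pencil algebra (`KnifeEdge.lambdaBlockMainTerm`, `sq_sqrt_sub_le_lambdaBlockMainTerm`
p459168; `Repair.lambdaBlockMainTerm_eq_twoBlockPencil`, `twoBlockPencil_exists_neg_of_neg`, the saturating world,
RepairLambdaBlock; Sylvester `n = 2` `KnifeEdge.twoBlockPencil_nonneg_iff`, p458738) is CITED, not re-typed; nothing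
of p461166 / p462691 / p467353 is re-typed.

**C1 — the class (KILL word of record).** B-len was KILLED: of-record line ls-lead, cell STATUS 2026-08-26T19:19:33Z,
under director-frontier pre-authorisation 18:53:49Z, RATIFIED by director-frontier g6 19:31:07Z («§B-len KILL — OF
RECORD … KILL-draft v2.4 b46628540b6b957c §1 «KILL(B-len) INSIDE 𝒟_len GIVEN B-AH (E-014)» with the E-085 (c)-door
cited … candidates 0 of 189, no number load-bearing … family B-len DIES INTO §E»); countersignature ls-B-ref-1
(REF-B1) 19:15:24Z over v2.3 23f7f953463b7ce2, covering v2.4 (§2 class block unchanged); intake of record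
`Repair.blenWord3` / `familyBlen3` (RepairIntakeBlen p465008 / p469841 / p470514: 21 families; constructor `lam` =
`familyLambdaOverhangAll`, whose docstring lists «(u6) the one-piece Λχψ profile on the WHOLE range [0, θ] straddling
the wall — 0 design rows of record — statement only»). PREMISE OF THE WORD, BY NAME: «GIVEN B-AH (E-014, GLOBAL form —
exact Cauchy–Schwarz / positivity persists in the completed ⟨A⟩-world calculus of the class)». **The family theorems
below do not use B-AH; it is the premise for reading the displayed slots as (A)-world properties** (the CS slot
`LambdaWholeCS` IS the B-AH prediction for this piece class; its failure is the (c)-door, registry row E-085 «non-model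
main-order entry», open, used in no word). The sub-class text, VERBATIM (B-len/KILL-draft.md v2.4 §2):
«(L-b) arithmetic coefficient
classes on an OVERHANG piece [1, θ] (or whole profile [0, θ]) glued to an in-class bulk: Λχψ-type a(n) =
χψ(n)·(Λ^{∗k}/log^k P)(n)·v(z_n), k ≤ 2 (S1-Λ; rows E-070/E-071); …», inside the common box «finitely many PPE(ℚ[i])
pieces … on rational supports ⊂ [0, 2], of which AT LEAST ONE has top θ ∈ (1, 2) (wall R-b crossed: ν₁ = θ > 1) …
endgame ∈ {POS (fixed amplitudes), CS (free ι)} … family = Zhang's PRIME family ψ mod p, p ∼ P», and the Λ clause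
of the KILL sentence (§1, verbatim): «(Λχψ) a SIGN/PSD statement about the class off-diagonal main term — «X_Λ fails
CompletedCS: ∃ v, K_Λ(v) + 2Re X_Λ(v,v) < 0 or |X_Λ(u,v)|² > 𝔅(u)(K_Λ(v) + 2Re X_Λ(v,v))» (E-071 with sign,
XL-substantive by RANGE: primes at length p^θ to prime moduli p) — because the class diagonal K_Λ ≥ 0 (E-070, PNT
rule, S) makes Cstar = 0 and the required strength Creq ≤ K/(2N_θ²) → 0 (§5), so C-boundedness is no protection and
only the SIGN decides». Members of record: NONE — DESIGN-MAP-len.md v0.8 466a1df1b6d1231c has 0 rows with a Λ-profile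
straddling the wall (all 54 `len-lam-*` rows of BATCH-1v2.json c516b3bb5a4103db / BATCH-3.json 7e2b17898a96282a are
`supp [1,θ]`, members of `familyLambdaOverhangAll`); this row is STATEMENT-LEVEL coverage of the word's parenthesis (whether it becomes a `blenWord4` constructor
`lamWhole` or only an `R⁺⁺` row is ls-Blen-plan's reading of the §2 (L-b) text quoted below, rider (r2) — ANSWERED
2026-08-26T23:53:33Z by ls-Blen-plan g3: INSIDE THE WORD ⇒ `blenWord4` constructor `lamWhole` (RepairIntakeBlen Part 7,
p476079) and row 39 of `Repair.Rplusplus12` (p477072); **REF-E E-26 PASS** (ls-barrier-ref g2, verdict 43,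
2026-08-27T00:29Z, CONDITIONAL «GIVEN B-AH»; notes non-blocking: N1 the row supersedes nothing — rows 25–26 keep their
members and ids E-070/E-071; N2 the class fixes `L.top = θ`, so the design's `θ` field is redundant data, harmless; N3
v1 of this docstring said «REF-E candidate E-21» — a numbering slip, E-21 is `familyGramBordered`; the entry of record is
E-26). ERRATUM v2 (2026-08-27, docstring only, 0 declarations touched): this parenthesis updated with the answer to (r2)
and the verdict; nothing else changed),
with a witness by term (C4: `Repair.lenLamWholeArch`, a polynomial arch on `[0,θ]` over the bulk `ϰ(1,k)`; and every
overhang member of record transported, `Repair.LambdaOverhangDesign.InClass.toWhole`).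
Lean class = `Repair.LambdaWholeDesign.InClass`: `Repair.KinkedProfile u u′` ∧ `u 1 = 0` ∧
`KnifeEdge.LambdaPiece.Whole d.θ d.L d.v′` (convolution order `k ≥ 1`, `top = θ > 1`, profile continuous on the bulk
part `[0,1)` and on the overhang part `[1,θ]` — a jump or kink AT the wall is allowed, as for PPE pieces glued at the
wall —, a marked right derivative on `(0,θ) ∖ {1}` square-integrable on each part, bounded; NO analytic hypothesis
inside). DECLARED DIFFERENCES (none silent): (i) WIDER — any `θ > 1` (the word: `θ ∈ (1,2)`; narrowing n-len-3
carried), any `k ≥ 1` (the word: `k ≤ 2`), any bounded two-part `C⁰` profile with `L²` marked derivative (the word: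
PPE(ℚ[i]); every polynomial profile on `[0,θ]` is a member, `KnifeEdge.whole_wholePolyPiece`), any amplitude; and the
class CONTAINS the overhang class (`KnifeEdge.LambdaPiece.Overhang.whole`: an overhang piece is a whole-range piece
with zero bulk part) — the overhang row `familyLambdaOverhangAll` is NOT superseded: it stays the word's E-070/E-071
row (its slots quantify over overhang pieces only, i.e. are WEAKER hypotheses), and COVERAGE IS COUNTED THERE for all
54 Λ rows; this row adds the straddlers (0 rows) and, for overhang members, a verdict under stronger slots
(`Repair.familyLambdaWholeAll_verdict_of_overhang_verdict`) — RIDER (r1) of the §E GO (ls-barrier-plan g1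
23:12:38Z), verbatim: «class WIDER (whole range) ⇒ slots STRONGER (re-quantified over the larger piece class) — a
weaker theorem per design than rows 25–26 on their common members; coverage counted CONDITIONAL and ONCE (the overhang
rows keep their members)»; (ii) the slots of THIS row are the E-070/E-071
PREDICATES re-quantified over the larger piece class (`LambdaWholeDiagNonneg θ K`: `K ≥ 0` on every whole-range piece
of top `θ`; `LambdaWholeCS θ K X`: `|κ_×(u,L)|² ≤ 𝔅(u)·K(L)` on every member) — the same B-AH prediction on a wider
class, hence STRONGER hypotheses; no new registry id is claimed (ids E-070/E-071 name the overhang part, E-030's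
`LambdaDiagNonneg`/`LambdaBlockCS` the in-length part `top ≤ 1`; a whole-range piece of top `θ > 1` is neither, so the
quantification here is the third instance of the one prediction — ls-obj-plan may book it as a sub-row or not);
(iii) the in-class side is ONE kinked continuous `H¹` profile on `[0,1]` with `u(1) = 0`, exactly as in p467353 (a bulk
with wall value `u(1⁻) ≠ 0` or interior jumps = 𝒟_multi coordinates, KILLED 18:10:26Z into `RepairIntakeBmulti`; a
design with TWO Λ-pieces read as three blocks = the Gram shape `KnifeEdge.familyGramBlockAll`, not this file);
(iv) the μψ and νψ clauses of (L-b) are `RepairBlenMuNu` (p469249 / p473090) and `RepairBlenNuLipschitz` (p470276); the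
narrowings n-len-1 (general bounded `a(n)` = STATEMENT ONLY — no family may claim it), n-len-2, n-len-3 are carried
verbatim and NOT claimed.

| family (this file) | sub-class of 𝒟_len | currency | displayed slots (kind (c), WORLD binders) | flag |
|---|---|---|---|---|
| `familyLambdaWholeAll` (+ per-world `familyLambdaWhole K X`) | (L-b)∣Λ, k ≥ 1, ONE Λχψ piece with profile on the WHOLE range `[0,θ]`, θ > 1 (⊇ the overhang class) | MODEL (block constant `lambdaBlockMainTerm K X u u′ L c` in the world `(K, X)`; E-070-type diagonal sign, E-071-type SIGN/PSD = E*-len strength) | `LambdaWholeDiagNonneg θ K` ∧ `LambdaWholeCS θ K X` — the E-070/E-071 predicates over whole-range pieces (STRONGER than the overhang slots); diagonal redundant given CS (`lambdaWholeDiagNonneg_of_cs`) | CONDITIONAL «closing excluded GIVEN B-AH (E-014)»: the CS slot is the B-AH prediction; threshold `lambdaWholeNull_iff`; (c)-door = `LambdaWholeIndefinite` (E-085 shape); 0 rows of record (statement-level coverage of u6) |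

**C3 — currency and displayed slots (REF-E C3/C3(e)).** MODEL currency, as rows 25–26 of the class of record: the
verdict is about the model constant `lambdaBlockMainTerm K X u u′ L c = 𝔅(u) + 2Re(κ_×(u,L)c) + |c|²K(L)` in a
parameter world `(K, X)` at the design's top `θ`. That the (A)-world main term of a whole-range Λ design IS such a block
for some `(K, X)` is a dictionary of the shape `KnifeEdge.ELambdaOverhang` with the piece binder widened — open, not
claimed, not typed here (no dictionary `Prop` is introduced: this file adds NO named fact). Displayed slots, kind (c),
never folded into the class: `LambdaWholeDiagNonneg θ K` (PROVED for every explicit candidate with a non-negative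
weight on `[0,θ]`, `KnifeEdge.lambdaWholeDiagNonneg_of_weight`) and `LambdaWholeCS θ K X`. Their failure on a member
= `Repair.LambdaWholeIndefinite θ K X` = the KILL sentence's «X_Λ fails CompletedCS» = the (c)-door E-085 shape.
**«Only the SIGN decides»** (the word's §1/§5) is carried as THEOREMS: `Cstar = 0` on the class
(`KnifeEdge.not_eLambdaWholeCloses_zero`: the input `X = 0` never closes), and in kernel form the class closes by
positivity IFF the derived block violates CS on a member (`Repair.eLambdaWholeCloses_iff_indefinite`), whatever its
size. C3(c′): the slots are INHABITED WITH EQUALITY on the class (`Repair.saturatingWorld_whole_slots`) and the CS slot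
is LOAD-BEARING on every member (`Repair.lambdaWholeCross_slot_loadBearing`) and on the witness of record
(`Repair.lambdaWholeCross_slot_loadBearing_arch`).

**Contents.** Part 1 (namespace `KnifeEdge`, the vocabulary next to p461166's): `LambdaPiece.Whole θ L v′`,
`LambdaPiece.Overhang.whole` (overhang ⊆ whole), `lambdaWholeDiag θ w` / `lambdaWholeDiagNonneg_of_weight` / `_id`
(explicit candidate `∫₀^θ w|prof|²`, sign `+` for `w ≥ 0`), the slots `LambdaWholeDiagNonneg` / `LambdaWholeCS` with
their restrictions to the overhang class (`LambdaWholeDiagNonneg.overhang`, `LambdaWholeCS.overhang`), the decision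
`ELambdaWholeCloses`, `not_eLambdaWholeCloses_of_cs`, `eLambdaWholeCloses_of_indefinite`, `not_eLambdaWholeCloses_zero`,
`eLambdaOverhangCloses.whole` (an overhang closing is a whole-range closing). Part 2 (namespace `Repair`): THE EXACT
CRITERION `lambdaWholeNull_iff : LambdaWholeNull θ K X ↔ LambdaWholeDiagNonneg θ K ∧ LambdaWholeCS θ K X`,
`lambdaWholeDiagNonneg_of_cs` (one slot suffices, tested on `ϰ_{1,5/2}`), `lambdaWholeNull_iff_cs`,
`eLambdaWholeCloses_iff_indefinite` (the (c)-door is the ONLY door), kernel-mode lemmas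
`lambdaWholeCross_eq_zero_of_kernelMode` / `eLambdaWholeCloses_of_kernelMode`. Part 3: the families —
`LambdaWholeDesign` / `.InClass`, `LambdaOverhangDesign.toWhole` / `InClass.toWhole` (C2: every (L-b)∣Λ overhang
member is a member), `familyLambdaWhole K X` / `_decided` / `_verdict_of_cs` / `rplus_lambdaWhole_decided`, the CLOSED
term `familyLambdaWholeAll` / `_iff` / `_decided_iff` / `_decided` / `rplus_lambdaWholeAll_decided`, unbundled
`not_repairable_lambdaWhole`, class reading `familyLambdaWholeAll_decided_iff_not_closes` / `_not_closes`, per-top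
exactness `lambdaWhole_null_iff_cs`, C2 at amplitude zero `familyLambdaWholeAll_verdict_of_amplitude_zero`, the
overhang relation `familyLambdaWholeAll_verdict_of_overhang_verdict` (whole slots ⇒ overhang slots ⇒ the overhang
row's verdict transports) and disjointness from M2 `not_admissible_of_whole`. Part 4 — C4: `wholePolyProf` /
`wholePolyProf'` / `wholePolyPiece` / `whole_wholePolyPiece` (every polynomial profile on `[0,θ]`, `k ≥ 1`, `θ > 1`),
the arch `archPoly θ = (4/θ²)·z(θ − z)` (`archPoly_eval`, value `1` at `z = θ/2 < 1` for `θ < 2`: the profile is live on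
BOTH sides of the wall), `lenLamWholeArch θ k c` / `inClass_lenLamWholeArch` / `verdict_lenLamWholeArch`, and the
transported member of record `inClass_lenLamBump_toWhole`. Part 5 — C3(c′): `saturatingWorld_whole_slots`,
`lambdaWholeCross_slot_loadBearing`, `lambdaWholeCross_slot_loadBearing_arch`. No numeric certificate is consumed;
axioms standard. References: Zhang, arXiv:2211.02515v1, §2 (2.15), (2.18), (2.23)–(2.25), (2.27), Lemma 2.3; §7 Prop
7.1 (7.2) p.44 [cite: Zhang2022LandauSiegel, §2 Lemma 2.3, §7 Prop 7.1 (7.2)]; R. Horn, C. Johnson, *Matrix Analysis*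
2nd ed., Thm 7.2.5 [cite: HornJohnson2013, Thm 7.2.5]; cell files B-len/KILL-draft.md v2.4 §1/§2/§6, B-len/DESIGN-MAP-len.md
v0.8, Zhang2022/RepairIntakeBlen.lean Part 5/6 docstrings (u6), barrier/REF-E.md E-15, barrier/ASSIGNMENTS.md (S-E-bt1-1).
«The programme SEARCHES and TYPES; no claim about Landau–Siegel zeros, Theorems 1–2 of arXiv:2211.02515 or a repaired
Margin232 until a kernel theorem says so.»
-/

noncomputable section

open Complex Real Set
open _root_.MeasureTheory

namespace Literature.NumberTheory.LFunctions.Zhang2022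

namespace KnifeEdge

open Repair Skeleton

variable {θ : ℝ} {K : LambdaDiag} {X : LambdaCross}

/-! ### Part 1 — the Λ-piece on the WHOLE range `[0, θ]` and the slots over it -/

/-- **Whole-range admissibility of a Λ-piece** (the (L-b) parenthesis «(or whole profile [0, θ])»): convolution order
`k ≥ 1`, logarithmic top `top = θ > 1`, profile continuous on the bulk part `[0,1)` and on the overhang part `[1,θ]`
(glued at the wall: a jump or a kink at `z = 1` is allowed), a marked right derivative `v′` on `(0,θ) ∖ {1}` that is
square-integrable on each part, bounded. NO vanishing below the wall (that is the overhang class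
`LambdaPiece.Overhang`, p461166, which this class contains: `LambdaPiece.Overhang.whole`). Only the values on
`[0, θ)` are read by `KnifeEdge.lambdaPoly` (`1 ≤ n < ⌈P^θ⌉`). [cite: Zhang2022LandauSiegel, §7 (7.2) p.44] -/
structure LambdaPiece.Whole (θ : ℝ) (L : LambdaPiece) (v' : ℝ → ℂ) : Prop where
  order : 1 ≤ L.k
  top_eq : L.top = θ
  one_lt : 1 < θ
  cont0 : ContinuousOn L.prof (Ico 0 1)
  cont1 : ContinuousOn L.prof (Icc 1 θ)
  hasDeriv : ∀ x ∈ Ioo (0:ℝ) θ, x ≠ 1 → HasDerivWithinAt L.prof (v' x) (Ioi x) x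
  memLp0 : MemLp v' 2 (volume.restrict (Ioo 0 1))
  memLp1 : MemLp v' 2 (volume.restrict (Ioc 1 θ))
  bdd : ∃ B : ℝ, ∀ z, ‖L.prof z‖ ≤ B

/-- **The overhang class is contained in the whole-range class:** an overhang piece (zero below the wall) is a
whole-range piece with zero bulk part. [cite: Zhang2022LandauSiegel, §7 (7.2) p.44] -/
theorem LambdaPiece.Overhang.whole {L : LambdaPiece} {v' : ℝ → ℂ} (h : L.Overhang θ v') : L.Whole θ v' where
  order := h.order
  top_eq := h.top_eq
  one_lt := h.one_lt
  cont0 := continuousOn_const.congr fun z hz => h.vanish z hz.2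
  cont1 := h.cont
  hasDeriv := by
    intro x hx hx1
    rcases lt_or_gt_of_ne hx1 with hlt | hgt
    · -- below the wall the profile is locally `0` and `v′ x = 0`
      have hzero : HasDerivWithinAt (fun _ : ℝ => (0:ℂ)) 0 (Ioi x) x := hasDerivWithinAt_const x (Ioi x) 0
      have heq : ∀ᶠ z in nhdsWithin x (Ioi x), L.prof z = (fun _ : ℝ => (0:ℂ)) z := by
        filter_upwards [Ioo_mem_nhdsGT hlt] with z hz
        exact h.vanish z hz.2
      rw [h.vanish' x hlt]
      exact hzero.congr_of_eventuallyEq heq (h.vanish x hlt)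
    · exact h.hasDeriv x ⟨hgt, hx.2⟩
  memLp0 := by
    have hz : MemLp (fun _ : ℝ => (0:ℂ)) 2 (volume.restrict (Ioo (0:ℝ) 1)) := MemLp.zero'
    refine hz.ae_eq ?_
    filter_upwards [ae_restrict_mem measurableSet_Ioo] with z hz'
    exact (h.vanish' z hz'.2).symm
  memLp1 := h.memLp
  bdd := h.bdd

/-- **`K_w(L) = ∫₀^θ w(z)‖prof(z)‖² dz` — the χ-FREE explicit candidate for the diagonal functional of a whole-range
Λ-piece** (bulk + overhang; the plain-PNT weight is `w(z) = z`; the formula-I-units weight is a derivation item, as for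
E-070 / E-030). [cite: Zhang2022LandauSiegel, §7 Prop 7.1 (7.2) p.44] -/
def lambdaWholeDiag (θ : ℝ) (w : ℝ → ℝ) : LambdaDiag := fun L => ∫ z in (0:ℝ)..θ, w z * ‖L.prof z‖ ^ 2

/-- Unfolding lemma. [cite: Zhang2022LandauSiegel, §7 (7.2) p.44] -/
theorem lambdaWholeDiag_apply (θ : ℝ) (w : ℝ → ℝ) (L : LambdaPiece) :
    lambdaWholeDiag θ w L = ∫ z in (0:ℝ)..θ, w z * ‖L.prof z‖ ^ 2 := rfl

/-- **sign `+`**: for a non-negative weight on `[0,θ]`, `θ ≥ 0`, the candidate diagonal is `≥ 0`.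
[cite: Zhang2022LandauSiegel, §7 Prop 7.1 (7.2) p.44] -/
theorem lambdaWholeDiag_nonneg {θ : ℝ} (hθ : 0 ≤ θ) {w : ℝ → ℝ} (hw : ∀ z ∈ Icc 0 θ, 0 ≤ w z) (L : LambdaPiece) :
    0 ≤ lambdaWholeDiag θ w L :=
  intervalIntegral.integral_nonneg hθ fun z hz => mul_nonneg (hw z hz) (sq_nonneg _)

/-- **Slot «sign +» over the whole-range class** (the E-070 predicate re-quantified over whole-range pieces): `K ≥ 0`
on every whole-range Λ-piece of top `θ`. Candidate shape, asserted for no `K`. [cite: Zhang2022LandauSiegel, §7 Prop 7.1 (7.2) p.44] -/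
def LambdaWholeDiagNonneg (θ : ℝ) (K : LambdaDiag) : Prop :=
  ∀ (L : LambdaPiece) (v' : ℝ → ℂ), L.Whole θ v' → 0 ≤ K L

/-- the explicit candidate with a non-negative weight satisfies the sign slot (θ > 1 is inside `Whole`).
[cite: Zhang2022LandauSiegel, §7 Prop 7.1 (7.2) p.44] -/
theorem lambdaWholeDiagNonneg_of_weight {θ : ℝ} {w : ℝ → ℝ} (hw : ∀ z ∈ Icc 0 θ, 0 ≤ w z) :
    LambdaWholeDiagNonneg θ (lambdaWholeDiag θ w) :=
  fun L _ hL => lambdaWholeDiag_nonneg (zero_le_one.trans hL.one_lt.le) hw L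

/-- the plain-PNT weight `w(z) = z` is admissible on `[0,θ]`. [cite: Zhang2022LandauSiegel, §7 (7.2) p.44] -/
theorem lambdaWholeDiagNonneg_id {θ : ℝ} : LambdaWholeDiagNonneg θ (lambdaWholeDiag θ fun z => z) :=
  lambdaWholeDiagNonneg_of_weight fun _ hz => hz.1

/-- **Slot (B1) over the whole-range class** (the E-071 predicate re-quantified): the cross is Cauchy–Schwarz-
subordinate, `|κ_×(u,L)|² ≤ 𝔅(u)·K(L)`, on every in-class `u` and every whole-range piece of top `θ` (prediction
B-AH; asserted for no `(K, X)`). [cite: Zhang2022LandauSiegel, §2 Lemma 2.3, (2.15)] -/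
def LambdaWholeCS (θ : ℝ) (K : LambdaDiag) (X : LambdaCross) : Prop :=
  ∀ (u u' : ℝ → ℂ) (L : LambdaPiece) (v' : ℝ → ℂ), KinkedProfile u u' → u 1 = 0 → L.Whole θ v' →
    ‖X u u' L‖ ^ 2 ≤ mainTermForm u u' * K L

/-- The whole-range sign slot restricts to the overhang sign slot (E-070): a STRONGER hypothesis.
[cite: Zhang2022LandauSiegel, §7 Prop 7.1 (7.2) p.44] -/
theorem LambdaWholeDiagNonneg.overhang (h : LambdaWholeDiagNonneg θ K) : LambdaOverhangDiagNonneg θ K :=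
  fun L v' hL => h L v' hL.whole

/-- The whole-range CS slot restricts to the overhang CS slot (E-071): a STRONGER hypothesis.
[cite: Zhang2022LandauSiegel, §2 Lemma 2.3, (2.15)] -/
theorem LambdaWholeCS.overhang (h : LambdaWholeCS θ K X) : LambdaOverhangCS θ K X :=
  fun u u' L v' hu hu1 hL => h u u' L v' hu hu1 hL.whole

/-- **The whole-range block CLOSES — the decision statement** (POS currency): some member (kinked in-class `u` with
`u(1) = 0`, ONE whole-range Λ-piece of top `θ`, any amplitude) has a NEGATIVE model constant.
[cite: Zhang2022LandauSiegel, §7 Prop 7.1 (7.2)] -/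
def ELambdaWholeCloses (θ : ℝ) (K : LambdaDiag) (X : LambdaCross) : Prop :=
  ∃ (u u' : ℝ → ℂ) (L : LambdaPiece) (v' : ℝ → ℂ) (c : ℂ),
    KinkedProfile u u' ∧ u 1 = 0 ∧ L.Whole θ v' ∧ lambdaBlockMainTerm K X u u' L c < 0

/-- **(B1) bookkeeping — the «no» word for the whole-range class:** with `K ≥ 0` and a CS-subordinate cross on the
class, no member closes (block value `≥ (√𝔅(u) − |c|√K)² ≥ 0`, `sq_sqrt_sub_le_lambdaBlockMainTerm`).
[cite: Zhang2022LandauSiegel, §2 Lemma 2.3, (2.15)] -/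
theorem not_eLambdaWholeCloses_of_cs (hK : LambdaWholeDiagNonneg θ K) (hX : LambdaWholeCS θ K X) :
    ¬ ELambdaWholeCloses θ K X := by
  rintro ⟨u, u', L, v', c, hu, hu1, hL, hneg⟩
  have hB : 0 ≤ mainTermForm u u' := mainTermForm_nonneg_of_isH1 hu.isH1
  have h := sq_sqrt_sub_le_lambdaBlockMainTerm hB (hK L v' hL) (hX u u' L v' hu hu1 hL) c
  exact not_lt.2 ((sq_nonneg _).trans h) hneg

/-- **Indefinite ⇒ closes:** a member with `𝔅(u)·K(L) < |κ_×(u,L)|²` and `K(L) > 0` closes, at the amplitude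
`c = −κ̄_×/K` (`lambdaBlockMainTerm_neg_of_indefinite`). [cite: Zhang2022LandauSiegel, §7 Prop 7.1 (7.2)] -/
theorem eLambdaWholeCloses_of_indefinite {u u' : ℝ → ℂ} {L : LambdaPiece} {v' : ℝ → ℂ}
    (hu : KinkedProfile u u') (hu1 : u 1 = 0) (hL : L.Whole θ v') (hK : 0 < K L)
    (h : mainTermForm u u' * K L < ‖X u u' L‖ ^ 2) : ELambdaWholeCloses θ K X :=
  ⟨u, u', L, v', _, hu, hu1, hL, lambdaBlockMainTerm_neg_of_indefinite hK h⟩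

/-- **«NO by itself»: with NO cross input (`X = 0`) no whole-range design closes** when `K ≥ 0` on the class — so
`Cstar = 0` on the class (the input `0` is `C`-bounded for every `C ≥ 0`). [cite: Zhang2022LandauSiegel, §7 Prop 7.1 (7.2) p.44] -/
theorem not_eLambdaWholeCloses_zero (hK : LambdaWholeDiagNonneg θ K) : ¬ ELambdaWholeCloses θ K 0 := by
  refine not_eLambdaWholeCloses_of_cs hK fun u u' L v' hu _ hL => ?_
  simpa using mul_nonneg (mainTermForm_nonneg_of_isH1 hu.isH1) (hK L v' hL)

/-- An overhang closing (p461166's `ELambdaOverhangCloses`) is a whole-range closing in the same world.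
[cite: Zhang2022LandauSiegel, §7 Prop 7.1 (7.2)] -/
theorem ELambdaOverhangCloses.whole (h : ELambdaOverhangCloses θ K X) : ELambdaWholeCloses θ K X := by
  obtain ⟨u, u', L, v', c, hu, hu1, hL, hneg⟩ := h
  exact ⟨u, u', L, v', c, hu, hu1, hL.whole, hneg⟩

end KnifeEdge

namespace Repair

open KnifeEdge

variable {θ : ℝ} {K : LambdaDiag} {X : LambdaCross} {u u' : ℝ → ℂ} {L : LambdaPiece} {v' : ℝ → ℂ}

/-! ### Part 2 — the exact criterion of the WHOLE-RANGE Λ block (model world `(K, X)` at top `θ`) -/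

/-- **NULL of the model world `(K, X)` at top `θ` on the whole-range class:** no member has a negative model
constant — the negation of `ELambdaWholeCloses θ K X`. Candidate shape, NOT asserted for any world.
[cite: Zhang2022LandauSiegel, §7 Prop 7.1 (7.2)] -/
def LambdaWholeNull (θ : ℝ) (K : LambdaDiag) (X : LambdaCross) : Prop :=
  ∀ (u u' : ℝ → ℂ) (L : LambdaPiece) (v' : ℝ → ℂ) (c : ℂ), KinkedProfile u u' → u 1 = 0 → L.Whole θ v' →
    0 ≤ lambdaBlockMainTerm K X u u' L c

/-- **The EDGE-REPORT shape on the whole-range class** ((c)-door E-085 shape): the derived block is INDEFINITE on some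
member — `𝔅(u)·K(L) < |κ_×(u,L)|²`. [cite: Zhang2022LandauSiegel, §7 Prop 7.1 (7.2)] -/
def LambdaWholeIndefinite (θ : ℝ) (K : LambdaDiag) (X : LambdaCross) : Prop :=
  ∃ (u u' : ℝ → ℂ) (L : LambdaPiece) (v' : ℝ → ℂ), KinkedProfile u u' ∧ u 1 = 0 ∧ L.Whole θ v' ∧
    mainTermForm u u' * K L < ‖X u u' L‖ ^ 2

/-- Closing is the failure of the null. [cite: Zhang2022LandauSiegel, §7 Prop 7.1 (7.2)] -/
theorem eLambdaWholeCloses_iff_not_null : ELambdaWholeCloses θ K X ↔ ¬ LambdaWholeNull θ K X := by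
  unfold ELambdaWholeCloses LambdaWholeNull
  push Not
  constructor
  · rintro ⟨u, u', L, v', c, hu, hu1, hL, h⟩
    exact ⟨u, u', L, v', c, hu, hu1, hL, h⟩
  · rintro ⟨u, u', L, v', c, hu, hu1, hL, h⟩
    exact ⟨u, u', L, v', c, hu, hu1, hL, h⟩

/-- **A negative Λ-diagonal closes, in EVERY cross world** (member `0 ⊕ c·λ`, `Repair.twoBlockPencil_exists_neg_of_neg`).
[cite: Zhang2022LandauSiegel, §7 Prop 7.1 (7.2)] -/
theorem eLambdaWholeCloses_of_negDiag (h : ∃ (L : LambdaPiece) (v' : ℝ → ℂ), L.Whole θ v' ∧ K L < 0) :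
    ELambdaWholeCloses θ K X := by
  obtain ⟨L, v', hL, hneg⟩ := h
  obtain ⟨s, hs⟩ := twoBlockPencil_exists_neg_of_neg hneg (X (fun _ => (0:ℂ)) (fun _ => (0:ℂ)) L)
    (mainTermForm (fun _ => (0:ℂ)) (fun _ => (0:ℂ)))
  refine ⟨fun _ => 0, fun _ => 0, L, v', s, kinkedProfile_zero, rfl, hL, ?_⟩
  rw [lambdaBlockMainTerm_eq_twoBlockPencil]
  exact hs

/-- **THE EXACT CRITERION of the whole-range Λ block (model world):** no member closes iff the diagonal is `≥ 0` on
the class AND the coupling is Cauchy–Schwarz-subordinate — an iff with `≤` (degenerate amplitudes and in-class kernel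
modes included). (←) = `sq_sqrt_sub_le_lambdaBlockMainTerm`; (→) = Sylvester `n = 2`
(`KnifeEdge.twoBlockPencil_nonneg_iff`) after `eLambdaWholeCloses_of_negDiag`. [cite: HornJohnson2013, Thm 7.2.5] -/
theorem lambdaWholeNull_iff : LambdaWholeNull θ K X ↔ LambdaWholeDiagNonneg θ K ∧ LambdaWholeCS θ K X := by
  constructor
  · intro h
    have hK : LambdaWholeDiagNonneg θ K := by
      intro L v' hL
      by_contra hneg
      push Not at hneg
      exact (eLambdaWholeCloses_iff_not_null.1 (eLambdaWholeCloses_of_negDiag (X := X) ⟨L, v', hL, hneg⟩)) h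
    refine ⟨hK, fun u u' L v' hu hu1 hL => ?_⟩
    have hall : ∀ s : ℂ, 0 ≤ twoBlockPencil (K L) (X u u' L) (mainTermForm u u') s := fun s => by
      rw [← lambdaBlockMainTerm_eq_twoBlockPencil]
      exact h u u' L v' s hu hu1 hL
    have crit := (twoBlockPencil_nonneg_iff (hK L v' hL)).1 hall
    rw [mul_comm]
    exact crit.2
  · rintro ⟨hK, hX⟩ u u' L v' c hu hu1 hL
    have hB : 0 ≤ mainTermForm u u' := mainTermForm_nonneg_of_isH1 hu.isH1
    exact (sq_nonneg _).trans (sq_sqrt_sub_le_lambdaBlockMainTerm hB (hK L v' hL) (hX u u' L v' hu hu1 hL) c)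

/-- **The diagonal slot FOLLOWS from the CS slot**, tested on the in-class piece `u₀ = ϰ_{1,5/2}` (`𝔅(u₀) > 0`,
`KnifeEdge.mainTermForm_kappaP_one_pos`) — ONE displayed slot suffices. [cite: Zhang2022LandauSiegel, (2.23)–(2.25) p.9; §7 Prop 7.1 (7.2)] -/
theorem lambdaWholeDiagNonneg_of_cs (hX : LambdaWholeCS θ K X) : LambdaWholeDiagNonneg θ K := by
  intro L v' hL
  have h := hX (kappaP 1 (5/2)) (kappaP' 1 (5/2)) L v' (kinkedProfile_kappaP one_pos le_rfl)
    (kappaP_one one_pos le_rfl) hL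
  have hpos := mainTermForm_kappaP_one_pos
  by_contra hneg
  push Not at hneg
  have hprod : mainTermForm (kappaP 1 (5/2)) (kappaP' 1 (5/2)) * K L < 0 := mul_neg_of_pos_of_neg hpos hneg
  have hsq := sq_nonneg ‖X (kappaP 1 (5/2)) (kappaP' 1 (5/2)) L‖
  linarith

/-- … hence the criterion with the single slot: **no member closes iff the coupling is CS-subordinate.**
[cite: HornJohnson2013, Thm 7.2.5] -/
theorem lambdaWholeNull_iff_cs : LambdaWholeNull θ K X ↔ LambdaWholeCS θ K X :=
  ⟨fun h => (lambdaWholeNull_iff.1 h).2, fun h => lambdaWholeNull_iff.2 ⟨lambdaWholeDiagNonneg_of_cs h, h⟩⟩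

/-- An indefinite block is NOT Cauchy–Schwarz-subordinate on the class. [cite: Zhang2022LandauSiegel, §2 Lemma 2.3, (2.15)] -/
theorem lambdaWholeIndefinite_not_cs (h : LambdaWholeIndefinite θ K X) : ¬ LambdaWholeCS θ K X := by
  obtain ⟨u, u', L, v', hu, hu1, hL, hind⟩ := h
  intro hcs
  exact not_lt.2 (hcs u u' L v' hu hu1 hL) hind

/-- **THE ONLY DOOR: the whole-range model closes iff the derived block is INDEFINITE on some member** — the KILL
sentence's «X_Λ fails CompletedCS» (E-085 shape), with NO sign hypothesis on `K`.
[cite: Zhang2022LandauSiegel, §7 Prop 7.1 (7.2)] -/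
theorem eLambdaWholeCloses_iff_indefinite : ELambdaWholeCloses θ K X ↔ LambdaWholeIndefinite θ K X := by
  rw [eLambdaWholeCloses_iff_not_null, lambdaWholeNull_iff_cs]
  constructor
  · intro h
    unfold LambdaWholeCS at h
    push Not at h
    obtain ⟨u, u', L, v', hu, hu1, hL, hlt⟩ := h
    exact ⟨u, u', L, v', hu, hu1, hL, hlt⟩
  · exact lambdaWholeIndefinite_not_cs

/-- An overhang edge report (p467353's `LambdaOverhangIndefinite`) is a whole-range edge report in the same world.
[cite: Zhang2022LandauSiegel, §7 Prop 7.1 (7.2)] -/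
theorem LambdaOverhangIndefinite.whole (h : LambdaOverhangIndefinite θ K X) : LambdaWholeIndefinite θ K X := by
  obtain ⟨u, u', L, v', hu, hu1, hL, hlt⟩ := h
  exact ⟨u, u', L, v', hu, hu1, hL.whole, hlt⟩

/-- On an in-class KERNEL MODE (`𝔅(u) = 0`) the CS slot forces the Λ-coupling to VANISH. [cite: HornJohnson2013, Thm 7.2.5] -/
theorem lambdaWholeCross_eq_zero_of_kernelMode (hX : LambdaWholeCS θ K X) (hu : KinkedProfile u u')
    (hu1 : u 1 = 0) (hL : L.Whole θ v') (h0 : mainTermForm u u' = 0) : X u u' L = 0 := by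
  have h := hX u u' L v' hu hu1 hL
  rw [h0, zero_mul] at h
  exact norm_eq_zero.1 (pow_eq_zero_iff two_ne_zero |>.1 (le_antisymm h (sq_nonneg _)))

/-- **Kernel-mode tightness:** on a kernel mode with `K(L) > 0`, ANY nonzero coupling makes the block indefinite, so
the class closes. [cite: Zhang2022LandauSiegel, §7 Prop 7.1 (7.2)] -/
theorem eLambdaWholeCloses_of_kernelMode (hu : KinkedProfile u u') (hu1 : u 1 = 0) (hL : L.Whole θ v')
    (hK : 0 < K L) (h0 : mainTermForm u u' = 0) (hx : X u u' L ≠ 0) : ELambdaWholeCloses θ K X :=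
  eLambdaWholeCloses_of_indefinite hu hu1 hL hK (by
    rw [h0, zero_mul]
    exact pow_pos (norm_pos_iff.2 hx) 2)

/-! ### Part 3 — the families for the extension protocol of `RepairRplus` -/

/-- **A design of the sub-class (L-b)∣Λ «whole profile [0,θ]»:** the top `θ`, a side-1 in-class profile `u` (marked
right derivative `u′`), ONE Λ-type piece `L` (order `k`, top `θ`, profile on `[0,θ]`) with the marked derivative `v′`
of its profile on `(0,θ) ∖ {1}`, and the balanced amplitude `c` — realised by p459168's `lambdaDesign χ u L c Λ_s`.
[cite: Zhang2022LandauSiegel, §2 (2.23)–(2.25), (2.27); §7 (7.2)] -/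
structure LambdaWholeDesign where
  /-- the logarithmic top `θ` of the Λ-piece (`n < P^θ`) -/
  θ : ℝ
  /-- the in-class `χψ`-smooth side-1 profile -/
  u : ℝ → ℂ
  /-- its marked right derivative -/
  u' : ℝ → ℂ
  /-- the Λ-type piece (order, top, profile on `[0,θ]`) -/
  L : LambdaPiece
  /-- the marked right derivative of the Λ-profile on `(0,θ) ∖ {1}` -/
  v' : ℝ → ℂ
  /-- the balanced amplitude of the Λ-piece -/
  c : ℂ

/-- **Membership** (NO analytic hypothesis inside): `u` a kinked `H¹` profile on `[0,1]` with `u(1) = 0`, `L` a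
whole-range piece of top `θ` (`KnifeEdge.LambdaPiece.Whole`). [cite: Zhang2022LandauSiegel, §7 (7.2)] -/
structure LambdaWholeDesign.InClass (d : LambdaWholeDesign) : Prop where
  kinked : KinkedProfile d.u d.u'
  wall : d.u 1 = 0
  whole : d.L.Whole d.θ d.v'

/-- A member's top is beyond the wall. [cite: Zhang2022LandauSiegel, §7 (7.2)] -/
theorem LambdaWholeDesign.InClass.one_lt {d : LambdaWholeDesign} (hd : d.InClass) : 1 < d.θ :=
  hd.whole.one_lt

/-- The same data read as a whole-range design (an overhang design IS a whole-range design as data).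
[cite: Zhang2022LandauSiegel, §7 (7.2)] -/
def LambdaOverhangDesign.toWhole (d : LambdaOverhangDesign) : LambdaWholeDesign := ⟨d.θ, d.u, d.u', d.L, d.v', d.c⟩

/-- **C2 — every (L-b)∣Λ OVERHANG member (p467353's class) is a member of the whole-range class.**
[cite: Zhang2022LandauSiegel, §7 (7.2)] -/
theorem LambdaOverhangDesign.InClass.toWhole {d : LambdaOverhangDesign} (hd : d.InClass) : d.toWhole.InClass :=
  ⟨hd.kinked, hd.wall, hd.ovh.whole⟩

/-- **The family «(L-b)∣Λ whole-range block in the model world `(K, X)`»**: verdict = with the two DISPLAYED slots at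
the design's top, `LambdaWholeDiagNonneg d.θ K` and `LambdaWholeCS d.θ K X` («GIVEN B-AH»), the member's model
constant is not negative. [cite: Zhang2022LandauSiegel, §7 Prop 7.1 (7.2)] -/
def familyLambdaWhole (K : LambdaDiag) (X : LambdaCross) : DesignFamily where
  Design := LambdaWholeDesign
  InClass d := d.InClass
  Verdict d := LambdaWholeDiagNonneg d.θ K → LambdaWholeCS d.θ K X →
    ¬ (lambdaBlockMainTerm K X d.u d.u' d.L d.c < 0)

/-- **The whole-range family is decided in every model world** (by the (←) half of `lambdaWholeNull_iff`).
[cite: Zhang2022LandauSiegel, §7 Prop 7.1 (7.2)] -/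
theorem familyLambdaWhole_decided (K : LambdaDiag) (X : LambdaCross) : (familyLambdaWhole K X).Decided :=
  fun d hd hK hX => not_lt.2 (lambdaWholeNull_iff.2 ⟨hK, hX⟩ d.u d.u' d.L d.v' d.c hd.kinked hd.wall hd.whole)

/-- In fact the CS slot alone gives the verdict (`lambdaWholeDiagNonneg_of_cs`). [cite: Zhang2022LandauSiegel, §7 Prop 7.1 (7.2)] -/
theorem familyLambdaWhole_verdict_of_cs {d : LambdaWholeDesign} (hX : LambdaWholeCS d.θ K X) (hd : d.InClass) :
    ¬ (lambdaBlockMainTerm K X d.u d.u' d.L d.c < 0) :=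
  familyLambdaWhole_decided K X d hd (lambdaWholeDiagNonneg_of_cs hX) hX

/-- **Per-top EXACTNESS of the slot:** in the world `(K, X)`, every member of top `θ` has a non-negative model
constant IFF the CS slot holds at `θ`. [cite: HornJohnson2013, Thm 7.2.5] -/
theorem lambdaWhole_null_iff_cs (θ : ℝ) (K : LambdaDiag) (X : LambdaCross) :
    (∀ d : LambdaWholeDesign, d.InClass → d.θ = θ → 0 ≤ lambdaBlockMainTerm K X d.u d.u' d.L d.c) ↔
      LambdaWholeCS θ K X := by
  rw [← lambdaWholeNull_iff_cs]
  constructor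
  · intro h u u' L v' c hu hu1 hL
    exact h ⟨θ, u, u', L, v', c⟩ ⟨hu, hu1, hL⟩ rfl
  · rintro h d hd rfl
    exact h d.u d.u' d.L d.v' d.c hd.kinked hd.wall hd.whole

/-- **`R⁺ ++ [(L-b)∣Λ whole-range, in the world (K, X)]` is decided** (`Repair.rplus_extend`).
[cite: Zhang2022LandauSiegel, §2 (2.32)–(2.33); §7 Prop 7.1 (7.2)] -/
theorem rplus_lambdaWhole_decided (K : LambdaDiag) (X : LambdaCross) :
    ClassDecided (Rplus ++ [familyLambdaWhole K X]) :=
  rplus_extend (familyLambdaWhole_decided K X)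

/-- **The CLOSED family «(L-b)∣Λ whole-range, all model worlds»** (the shape the running assembly appends; worlds
quantified inside the verdict). [cite: Zhang2022LandauSiegel, §7 Prop 7.1 (7.2)] -/
def familyLambdaWholeAll : DesignFamily where
  Design := LambdaWholeDesign
  InClass d := d.InClass
  Verdict d := ∀ (K : LambdaDiag) (X : LambdaCross), LambdaWholeDiagNonneg d.θ K → LambdaWholeCS d.θ K X →
    ¬ (lambdaBlockMainTerm K X d.u d.u' d.L d.c < 0)

/-- Membership / verdict of the closed family versus the world-parametric one. [cite: Zhang2022LandauSiegel, §7 Prop 7.1 (7.2)] -/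
theorem familyLambdaWholeAll_iff (d : LambdaWholeDesign) :
    (familyLambdaWholeAll.InClass d ↔ ∀ (K : LambdaDiag) (X : LambdaCross), (familyLambdaWhole K X).InClass d) ∧
      (familyLambdaWholeAll.Verdict d ↔ ∀ (K : LambdaDiag) (X : LambdaCross), (familyLambdaWhole K X).Verdict d) :=
  ⟨⟨fun h _ _ => h, fun h => h (fun _ => 0) (fun _ _ _ => 0)⟩, Iff.rfl⟩

/-- The closed family is decided iff every world-parametric family is. [cite: Zhang2022LandauSiegel, §7 Prop 7.1 (7.2)] -/
theorem familyLambdaWholeAll_decided_iff :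
    familyLambdaWholeAll.Decided ↔ ∀ (K : LambdaDiag) (X : LambdaCross), (familyLambdaWhole K X).Decided :=
  ⟨fun h K X d hd => h d hd K X, fun h d hd K X => h K X d hd⟩

/-- **The closed whole-range (L-b)∣Λ family is decided.** [cite: Zhang2022LandauSiegel, §7 Prop 7.1 (7.2)] -/
theorem familyLambdaWholeAll_decided : familyLambdaWholeAll.Decided :=
  familyLambdaWholeAll_decided_iff.2 familyLambdaWhole_decided

/-- **`R⁺ ++ [(L-b)∣Λ whole-range, all worlds]` is decided.** [cite: Zhang2022LandauSiegel, §2 (2.32)–(2.33); §7 Prop 7.1 (7.2)] -/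
theorem rplus_lambdaWholeAll_decided : ClassDecided (Rplus ++ [familyLambdaWholeAll]) :=
  rplus_extend familyLambdaWholeAll_decided

/-- The verdict unbundled (every hypothesis a binder). [cite: Zhang2022LandauSiegel, §7 Prop 7.1 (7.2)] -/
theorem not_repairable_lambdaWhole (hK : LambdaWholeDiagNonneg θ K) (hX : LambdaWholeCS θ K X)
    (hu : KinkedProfile u u') (hu1 : u 1 = 0) (hL : L.Whole θ v') (c : ℂ) :
    ¬ (lambdaBlockMainTerm K X u u' L c < 0) :=
  familyLambdaWholeAll_decided ⟨θ, u, u', L, v', c⟩ ⟨hu, hu1, hL⟩ K X hK hX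

/-- **The class-level reading:** the closed family is decided IFF in every world `(θ, K, X)` carrying the two slots NO
member closes (`KnifeEdge.not_eLambdaWholeCloses_of_cs`; the family theorems do not use B-AH).
[cite: Zhang2022LandauSiegel, §2 Lemma 2.3, (2.15); §7 Prop 7.1 (7.2)] -/
theorem familyLambdaWholeAll_decided_iff_not_closes :
    familyLambdaWholeAll.Decided ↔
      ∀ (θ : ℝ) (K : LambdaDiag) (X : LambdaCross), LambdaWholeDiagNonneg θ K → LambdaWholeCS θ K X →
        ¬ ELambdaWholeCloses θ K X := by
  constructor
  · rintro h θ K X hK hX ⟨u, u', L, v', c, hu, hu1, hL, hneg⟩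
    exact h ⟨θ, u, u', L, v', c⟩ ⟨hu, hu1, hL⟩ K X hK hX hneg
  · intro h d hd K X hK hX hneg
    exact h d.θ K X hK hX ⟨d.u, d.u', d.L, d.v', d.c, hd.kinked, hd.wall, hd.whole, hneg⟩

/-- … in particular no world carrying the slots closes. [cite: Zhang2022LandauSiegel, §2 Lemma 2.3, (2.15)] -/
theorem familyLambdaWholeAll_not_closes (hK : LambdaWholeDiagNonneg θ K) (hX : LambdaWholeCS θ K X) :
    ¬ ELambdaWholeCloses θ K X :=
  familyLambdaWholeAll_decided_iff_not_closes.1 familyLambdaWholeAll_decided θ K X hK hX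

/-- **C2 — at amplitude `c = 0` the member is its in-class profile alone and the verdict is `R̄`'s positivity,
UNCONDITIONALLY** (E-14's `Repair.lambdaBlock_verdict_zero`, cited). [cite: Zhang2022LandauSiegel, §2 (2.18); §7 Prop 7.1 (7.2)] -/
theorem familyLambdaWholeAll_verdict_of_amplitude_zero {d : LambdaWholeDesign} (hu : KinkedProfile d.u d.u')
    (hc : d.c = 0) : familyLambdaWholeAll.Verdict d := fun K X _ _ => by
  rw [hc]
  exact lambdaBlock_verdict_zero K X hu d.L

/-- **C2 — relation to the overhang row (p467353):** on an overhang member the whole-range slots IMPLY the overhang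
slots, so the overhang row's verdict transports to this row's verdict on the same data (coverage stays counted under
`familyLambdaOverhangAll`; this row never weakens it). [cite: Zhang2022LandauSiegel, §7 Prop 7.1 (7.2)] -/
theorem familyLambdaWholeAll_verdict_of_overhang_verdict {d : LambdaOverhangDesign}
    (h : familyLambdaOverhangAll.Verdict d) : familyLambdaWholeAll.Verdict d.toWhole :=
  fun K X hK hX => h K X hK.overhang hX.overhang

/-- **The whole-range class is DISJOINT from B-multi's M2** (`Repair.familyLambdaBlock`): an M2-admissible piece has
`top ≤ 1`, a whole-range piece has `top = θ > 1`. [cite: Zhang2022LandauSiegel, §7 (7.2)] -/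
theorem not_admissible_of_whole (hL : L.Whole θ v') : ¬ L.Admissible := fun hA => by
  have h1 := hA.top_le
  rw [hL.top_eq] at h1
  exact not_lt.2 h1 hL.one_lt

/-! ### Part 4 — C4: the members as data (a polynomial profile on the whole range; the transported members of record) -/

section Members

/-- **A polynomial Λ-profile on the WHOLE range `[0, θ]`**, zero elsewhere. [cite: Zhang2022LandauSiegel, §7 (7.2) p.44] -/
def wholePolyProf (θ : ℝ) (p : Polynomial ℝ) (z : ℝ) : ℂ :=
  if 0 ≤ z ∧ z ≤ θ then ((p.eval z : ℝ) : ℂ) else 0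

/-- its marked derivative: `p′(z)` on `[0, θ]`, zero elsewhere. [cite: Zhang2022LandauSiegel, §7 (7.2) p.44] -/
def wholePolyProf' (θ : ℝ) (p : Polynomial ℝ) (z : ℝ) : ℂ :=
  if 0 ≤ z ∧ z ≤ θ then (((Polynomial.derivative p).eval z : ℝ) : ℂ) else 0

/-- the Λ-type piece of order `k` and top `θ` with a polynomial profile on `[0,θ]`. [cite: Zhang2022LandauSiegel, §7 (7.2) p.44] -/
def wholePolyPiece (θ : ℝ) (k : ℕ) (p : Polynomial ℝ) : LambdaPiece := ⟨k, θ, wholePolyProf θ p⟩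

/-- **Every polynomial piece on `[0,θ]` (order `k ≥ 1`, `θ > 1`) is a whole-range Λ-piece.**
[cite: Zhang2022LandauSiegel, §7 (7.2) p.44] -/
theorem whole_wholePolyPiece (hθ : 1 < θ) {k : ℕ} (hk : 1 ≤ k) (p : Polynomial ℝ) :
    (wholePolyPiece θ k p).Whole θ (wholePolyProf' θ p) := by
  have hcont : Continuous fun z : ℝ => ((p.eval z : ℝ) : ℂ) := Complex.continuous_ofReal.comp p.continuous
  have hcont' : Continuous fun z : ℝ => (((Polynomial.derivative p).eval z : ℝ) : ℂ) :=
    Complex.continuous_ofReal.comp (Polynomial.derivative p).continuous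
  obtain ⟨B, hB⟩ := (isCompact_Icc (a := (0:ℝ)) (b := θ)).exists_bound_of_continuousOn hcont.continuousOn
  obtain ⟨B', hB'⟩ := (isCompact_Icc (a := (0:ℝ)) (b := θ)).exists_bound_of_continuousOn hcont'.continuousOn
  have hmem : ∀ s : Set ℝ, MeasurableSet s → s ⊆ Icc 0 θ →
      MemLp (wholePolyProf' θ p) 2 (volume.restrict s) := by
    intro s hs hsub
    have hvol : volume s < ⊤ := lt_of_le_of_lt (measure_mono hsub) (by rw [Real.volume_Icc]; exact ENNReal.ofReal_lt_top)
    haveI : IsFiniteMeasure (volume.restrict s) := ⟨by rwa [Measure.restrict_apply_univ]⟩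
    have hm : MemLp (fun z : ℝ => (((Polynomial.derivative p).eval z : ℝ) : ℂ)) 2 (volume.restrict s) :=
      MemLp.of_bound hcont'.aestronglyMeasurable B'
        (by
          filter_upwards [ae_restrict_mem hs] with z hz
          exact hB' z (hsub hz))
    refine hm.ae_eq ?_
    filter_upwards [ae_restrict_mem hs] with z hz
    simp [wholePolyProf', (hsub hz).1, (hsub hz).2]
  exact
  { order := hk
    top_eq := rfl
    one_lt := hθ
    cont0 := by
      refine hcont.continuousOn.congr fun z hz => ?_
      simp [wholePolyPiece, wholePolyProf, hz.1, (hz.2.le.trans hθ.le)]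
    cont1 := by
      refine hcont.continuousOn.congr fun z hz => ?_
      simp [wholePolyPiece, wholePolyProf, (zero_le_one.trans hz.1), hz.2]
    hasDeriv := by
      intro x hx _
      have hd : HasDerivAt (fun z : ℝ => ((p.eval z : ℝ) : ℂ)) ((((Polynomial.derivative p).eval x : ℝ)) : ℂ) x :=
        (p.hasDerivAt x).ofReal_comp
      have heq : ∀ᶠ z in nhds x, (wholePolyPiece θ k p).prof z = ((p.eval z : ℝ) : ℂ) := by
        filter_upwards [Ioo_mem_nhds hx.1 hx.2] with z hz
        simp [wholePolyPiece, wholePolyProf, hz.1.le, hz.2.le]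
      have := (hd.congr_of_eventuallyEq heq).hasDerivWithinAt (s := Ioi x)
      simpa [wholePolyProf', hx.1.le, hx.2.le] using this
    memLp0 := hmem _ measurableSet_Ioo fun z hz => ⟨hz.1.le, hz.2.le.trans hθ.le⟩
    memLp1 := hmem _ measurableSet_Ioc fun z hz => ⟨zero_le_one.trans hz.1.le, hz.2⟩
    bdd := by
      refine ⟨max B 0, fun z => ?_⟩
      by_cases hz : 0 ≤ z ∧ z ≤ θ
      · have e : (wholePolyPiece θ k p).prof z = ((p.eval z : ℝ) : ℂ) := by simp [wholePolyPiece, wholePolyProf, hz]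
        rw [e]
        exact (hB z ⟨hz.1, hz.2⟩).trans (le_max_left _ _)
      · have e : (wholePolyPiece θ k p).prof z = 0 := by simp [wholePolyPiece, wholePolyProf, hz]
        rw [e, norm_zero]
        exact le_max_right _ _ }

/-- **The arch** `(4/θ²)·z(θ − z)` on `[0,θ]`: value `0` at both ends, peak `1` at `z = θ/2` — for `1 < θ < 2` the peak
lies BELOW the wall, so the profile is live on both sides of `z = 1` (a genuine straddler, not an overhang piece).
[cite: Zhang2022LandauSiegel, §7 (7.2) p.44] -/
def archPoly (θ : ℝ) : Polynomial ℝ := Polynomial.C (4 / θ ^ 2) * Polynomial.X * (Polynomial.C θ - Polynomial.X)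

/-- the arch's values. [cite: Zhang2022LandauSiegel, §7 (7.2) p.44] -/
theorem archPoly_eval (θ z : ℝ) : (archPoly θ).eval z = 4 / θ ^ 2 * z * (θ - z) := by
  simp [archPoly]

/-- the arch at the wall: `(archPoly θ)(1) = 4(θ − 1)/θ² ≠ 0` for `θ > 1` (the profile does not vanish below or at the
wall — it is not an overhang piece). [cite: Zhang2022LandauSiegel, §7 (7.2) p.44] -/
theorem archPoly_eval_one_pos (hθ : 1 < θ) : 0 < (archPoly θ).eval 1 := by
  rw [archPoly_eval]
  have : 0 < θ ^ 2 := by positivity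
  have h1 : 0 < θ - 1 := by linarith
  positivity

/-- at `θ = 5/4`: `(64/25)·z·(5/4 − z) = (16/5)z − (64/25)z²`. [cite: Zhang2022LandauSiegel, §7 (7.2) p.44] -/
theorem archPoly_eval_five_fourths (z : ℝ) : (archPoly (5/4)).eval z = 16 / 5 * z - 64 / 25 * z ^ 2 := by
  rw [archPoly_eval]
  ring

/-- **Witness member `len-lam-whole-arch-u{k}-th{θ}` at amplitude `c` (NOT a design of record — 0 rows straddle the
wall; a term exhibiting the class):** bulk `ϰ(1, k)` ⊕ the order-1 arch piece on `[0, θ]`.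
[cite: Zhang2022LandauSiegel, §2 (2.23)–(2.25); §7 (7.2)] -/
def lenLamWholeArch (θ k : ℝ) (c : ℂ) : LambdaWholeDesign :=
  ⟨θ, kappaP 1 k, kappaP' 1 k, wholePolyPiece θ 1 (archPoly θ), wholePolyProf' θ (archPoly θ), c⟩

/-- **C4 — the arch members are in the class** for every `θ > 1`, every twist `k`, every amplitude.
[cite: Zhang2022LandauSiegel, §2 (2.23)–(2.25); §7 (7.2)] -/
theorem inClass_lenLamWholeArch (hθ : 1 < θ) (k : ℝ) (c : ℂ) : (lenLamWholeArch θ k c).InClass :=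
  ⟨kinkedProfile_kappaP one_pos le_rfl, kappaP_one one_pos le_rfl, whole_wholePolyPiece hθ le_rfl _⟩

/-- … with their verdicts at the knot `θ = 5/4` (bulks `ϰ(1,5/2)` / `ϰ(1,3/2)`). [cite: Zhang2022LandauSiegel, §7 Prop 7.1 (7.2)] -/
theorem verdict_lenLamWholeArch (c : ℂ) :
    familyLambdaWholeAll.Verdict (lenLamWholeArch (5/4) (5/2) c) ∧
      familyLambdaWholeAll.Verdict (lenLamWholeArch (5/4) (3/2) c) :=
  ⟨familyLambdaWholeAll_decided _ (inClass_lenLamWholeArch (by norm_num) _ c),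
    familyLambdaWholeAll_decided _ (inClass_lenLamWholeArch (by norm_num) _ c)⟩

/-- **C4 — the members of record of the overhang row, transported:** `len-lam-bump-u{k}-th{θ}` (p467353's
`lenLamBump`) is a whole-range member (zero bulk part), with its verdict here.
[cite: Zhang2022LandauSiegel, §2 (2.23)–(2.25); §7 (7.2)] -/
theorem inClass_lenLamBump_toWhole (hθ : 1 < θ) (k : ℝ) (c : ℂ) :
    (lenLamBump θ k c).toWhole.InClass ∧ familyLambdaWholeAll.Verdict (lenLamBump θ k c).toWhole :=
  ⟨(inClass_lenLamBump hθ k c).toWhole,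
    familyLambdaWholeAll_decided _ (inClass_lenLamBump hθ k c).toWhole⟩

end Members

/-! ### Part 5 — C3(c′): the slots are inhabited (with equality) and load-bearing on the whole-range class -/

/-- **The slots are inhabited, with EQUALITY in the CS slot, on the whole-range class** (RepairLambdaBlock's
CS-saturating world `K ≡ 1`, `κ_×(u,L) = √𝔅(u)`): no verdict quantifying over slot-carrying worlds is vacuous, and the
CS slot cannot be sharpened to a strict inequality. [cite: Zhang2022LandauSiegel, §7 Prop 7.1 (7.2)] -/
theorem saturatingWorld_whole_slots (θ : ℝ) :
    LambdaWholeDiagNonneg θ saturatingDiag ∧ LambdaWholeCS θ saturatingDiag saturatingCross ∧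
      ∀ (u u' : ℝ → ℂ) (L : LambdaPiece), KinkedProfile u u' →
        ‖saturatingCross u u' L‖ ^ 2 = mainTermForm u u' * saturatingDiag L :=
  ⟨fun _ _ _ => zero_le_one, fun u u' L _ hu _ _ => (saturatingWorld_slots.2.2 u u' L hu).le,
    saturatingWorld_slots.2.2⟩

/-- **The CS slot is load-bearing on EVERY member:** for any in-class `u` and any whole-range `L` there is a world with
`K ≡ 1 > 0` (diagonal slot satisfied) in which `u ⊕ c·λ` closes — coupling `κ_× ≡ 𝔅(u) + 1`, indefinite since
`𝔅(u)·1 < (𝔅(u)+1)²`. So the verdict cannot drop `LambdaWholeCS`. [cite: Zhang2022LandauSiegel, §7 Prop 7.1 (7.2)] -/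
theorem lambdaWholeCross_slot_loadBearing (hu : KinkedProfile u u') (hu1 : u 1 = 0) (hL : L.Whole θ v') :
    ∃ (K : LambdaDiag) (X : LambdaCross), LambdaWholeDiagNonneg θ K ∧
      (∀ L' : LambdaPiece, 0 < K L') ∧ ELambdaWholeCloses θ K X ∧ ¬ LambdaWholeCS θ K X := by
  set a : ℝ := mainTermForm u u' with ha
  have ha0 : 0 ≤ a := mainTermForm_nonneg_of_isH1 hu.isH1
  have hind : LambdaWholeIndefinite θ (fun _ => 1) (fun _ _ _ => ((a + 1 : ℝ) : ℂ)) := by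
    refine ⟨u, u', L, v', hu, hu1, hL, ?_⟩
    change mainTermForm u u' * 1 < ‖((a + 1 : ℝ) : ℂ)‖ ^ 2
    rw [← ha, Complex.norm_real, Real.norm_eq_abs, sq_abs]
    nlinarith
  exact ⟨fun _ => 1, fun _ _ _ => ((a + 1 : ℝ) : ℂ), fun _ _ _ => zero_le_one, fun _ => one_pos,
    eLambdaWholeCloses_iff_indefinite.2 hind, lambdaWholeIndefinite_not_cs hind⟩

/-- **Instance on the witness:** `len-lam-whole-arch-u52-th5:4` closes in such a world (the slot is load-bearing on a
genuine straddler). [cite: Zhang2022LandauSiegel, §7 Prop 7.1 (7.2)] -/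
theorem lambdaWholeCross_slot_loadBearing_arch :
    ∃ (K : LambdaDiag) (X : LambdaCross), LambdaWholeDiagNonneg (5/4) K ∧
      (∀ L' : LambdaPiece, 0 < K L') ∧ ELambdaWholeCloses (5/4) K X ∧ ¬ LambdaWholeCS (5/4) K X :=
  have h := inClass_lenLamWholeArch (θ := 5/4) (by norm_num) (5/2) 0
  lambdaWholeCross_slot_loadBearing h.kinked h.wall h.whole

end Repair

end Literature.NumberTheory.LFunctions.Zhang2022
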